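import Literature.Barriers.HubbardSuperconductivity.GeneralizedHartreeFockNoPairing
import HarnessLib

/-!
# The barrier `GeneralizedHartreeFockNoPairing`, discharged under its canonical name

Barrier catalogue `Literature/Barriers/HubbardSuperconductivity/` (D-0021); companion of
`GeneralizedHartreeFockNoPairing`, which vendors AND PROVES, for the repulsive Hubbard model,
Bach–Lieb–Solovej's no-pairing theorem of generalized Hartree–Fock (BCS mean-field) theory:
V. Bach, E. H. Lieb, J. P. Solovej, *Generalized Hartree–Fock theory and the Hubbard model*,
J. Stat. Phys. **76** (1994) 3–89 = arXiv:cond-mat/9312044 (`BachLiebSolovej1994`, held as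
`paper:arxiv-cond-mat_9312044`), **Theorem 2.11** (p. 14): "If the operator `V` is positive (semi)
definite on `H ⊗ H`, `E^HF = inf{E(Γ) | Γ is admissible and normal, i.e., α = 0}` (2c.28).
Moreover, if `V` is strictly positive (i.e., positive definite) then any ground state (if it
exists) must be a normal state. Likewise, we have for the pressure
`P^HF(β) = sup{P_β(Γ) | Γ is admissible and normal}` (2c.29)", with its proof (2c.30)–(2c.32)
(the pairing energy is the quadratic form of `V` at `g = α`, hence `≥ 0`; "form a new operator `Γ̃`
by replacing `α` by zero. It is clear that `Γ̃` is still admissible and by (2c.31) that `E(Γ̃)` is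
(strictly) smaller than `E(Γ)` if `V` is (strictly) positive"; for the pressure "`Γ'` obtained by
changing `α` to `-α` is unitarily equivalent to `Γ`. Hence, since the entropy is a concave function
we find `S(Γ̃) = S(½Γ + ½Γ') ≥ ½S(Γ) + ½S(Γ') = S(Γ)`"), applied to the repulsive Hubbard model in
**§IV.a** (p. 32): "the interaction (corresponding to the operator `V` in Chapter II) is repulsive
and Theorem 2.11 applies. Hence, we may restrict our attention to 1-pdm of the form
`Γ = diag(γ, 1 - γ̄)`".

The companion file proves all six clauses of the named fact
`Literature.Barriers.HubbardSuperconductivity.GeneralizedHartreeFockNoPairing` as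
`generalizedHartreeFockNoPairing_holds` (from `GHFState.isAdmissible_normalPart`,
`hubbardGHFEnergy_normalPart_le`, `hubbardGHFInf_eq_normalInf`, `not_pairingLowersGHFEnergy`,
`isHubbardGHFGroundState_normalPart`, `onSitePairing_eq_zero_of_isHubbardGHFGroundState`,
`hubbardGHFNegPressure_normalPart_le`, `hubbardGHFPressureSup_eq_normalSup`). This file records
that discharge under the catalogue's canonical name `<Fact>_holds`, i.e.
`GeneralizedHartreeFockNoPairing_holds`, so that users of `(h : GeneralizedHartreeFockNoPairing)`
are fed by name. No new mathematics; no definitions.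

## References

* V. Bach, E. H. Lieb, J. P. Solovej, J. Stat. Phys. 76 (1994) 3–89, arXiv:cond-mat/9312044:
  Theorem 2.11 (2c.28)–(2c.29) with proof (2c.30)–(2c.32), p. 14; §IV.a (4a.1)–(4a.2), p. 32.
  [BachLiebSolovej1994]
-/

namespace Literature.Barriers.HubbardSuperconductivity

universe u

/-- **The barrier `GeneralizedHartreeFockNoPairing` holds** (canonical discharge name; the proof is
the companion file's `generalizedHartreeFockNoPairing_holds`): for every finite lattice `Λ`, hopping
matrix `t` and repulsive on-site interaction `U_x ≥ 0`, in generalized Hartree–Fock theory of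
`H_+ = Σ t_{xy} c†_{xσ}c_{yσ} + Σ_x U_x(n_{x↑} - ½)(n_{x↓} - ½)` — (1) dropping the pairing matrix
`α` of an admissible 1-pdm keeps it admissible and does not raise the energy (3a.7); (2)
`E^HF = inf over normal states` (2c.28); (3) `¬ PairingLowersGHFEnergy t U`; (4) the normal part of
a gHF ground state is a gHF ground state; (5) for `U_x > 0` every gHF ground state has zero
on-site pairing amplitudes; (6) for `β ≥ 0` and every `μ` the normal part has no smaller pressure
and `P^HF(β, μ) = sup over normal states` (2c.29).
[cite: BachLiebSolovej1994, Theorem 2.11 (2c.28)–(2c.29) with proof (2c.30)–(2c.32), p. 14;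
§IV.a (4a.1)–(4a.2), p. 32] -/
theorem GeneralizedHartreeFockNoPairing_holds : GeneralizedHartreeFockNoPairing.{u} :=
  generalizedHartreeFockNoPairing_holds

end Literature.Barriers.HubbardSuperconductivity
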